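import Literature.AlgebraicGeometry.Frobenioids.Cor54RigidityLinearTransport
import Literature.AlgebraicGeometry.Frobenioids.ArithmeticRealificationCoordinates
import Literature.AlgebraicGeometry.Frobenioids.ArithmeticFrobenioidModel
import Literature.NumberTheory.NumberFields.AutomorphismFixingPrimes
import HarnessLib

/-!
# Frobenioids I, Corollary 5.4 at `C_{K/F}` (row C54-core-arith, sub-row (4), step (B1)): a functorial
# self-map of the realification image preserves Frobenius degree `1` and identity base

Mochizuki, *The geometry of Frobenioids I: the general theory*, Kyushu J. Math. **62** (2008) 293–400,
Cor. 5.4 p. 104 (1-uniqueness of `Ψ^rlf`) for THE realification (Prop. 5.3 p. 103) of the arithmetic Frobenioid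
`C_{K/F}` of Ex. 6.3 p. 113 / Thm. 6.4 (i) p. 115. [cite: MochizukiFrdI2008, Cor. 5.4 p.104]
[cite: MochizukiFrdI2008, Ex. 6.3 p.113]

PROOF-ONLY (cell abc-iut, seat abc-iut-L1-d8; no definitions). Setting: `D = FinSubextCat F K`,
`Φ = arithDivisorFunctor F K` (objectwise perf-factorial, `hΦ'`), THE realification data
`R = RealificationData.canonical Φ hΦ'`, any subfunctor of groups `Ψ ⊆ Φ^gp`, and the functor of model Frobenioids
`G = (R.ofBaseData Ψ).functor : (Φ, Ψ)-model → (Φ^rlf, ℝ·Ψ)-model` (for `Ψ = Φ^birat`: `C_{K/F}^un-tr → C_{K/F}^rlf`).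
For a functorial self-map `ρ` of the homs between `G`-image objects fixing the `G f` and an identity-base linear
`k = (1, 𝟙_X, z, u) : G(X, γ) → G(X, γ')`, write `ρ(k) = (d̂, σ̂, ẑ, û)`.

* `FrdI.Cor54Sub.degFr_base_rho_linear_arith` — **`d̂ = 1` and `σ̂ = 𝟙_X`.**  By the generic translation
  identity `ModelFrobenioid.DataHom.rho_translate` (seat file `Cor54RigidityLinearTransport`), for every effective
  arithmetic divisor `w` on `L = X.L`: `ẑ_w + d̂ · ι(w) = σ̂^* ι(w) + ẑ` in `Φ(L)^rlf` with `ẑ_w` EFFECTIVE.  Read in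
  the coordinates `Θ : (Φ(L)^rlf)^gp ↪ ADiv_ℝ(L)` of seat abc-iut-L1-d2 (`ArithRlfCoord.exists_rlfGp_coordinates`:
  injective, `Θ ∘ ι =` the real divisor, effective ↦ coefficientwise `≥ 0`): `d̂ · w_p ≤ (σ̂^* w)_p + Θ(ẑ)_p` at every
  place `p`.  With `w = r · [w₀]` archimedean (`(σ̂^* w)_{w₀} ≤ r`) and `r → ∞`: `d̂ = 1`; with `w = n · [v]` finite
  (`(σ̂^* w)_v = e · n · [σ̂⁻¹ v = v]`, `ArithPullback.pullFinsupp_apply`) and `n → ∞`: `σ̂⁻¹ v = v` for every finite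
  `v`, whence `σ̂ = 𝟙` by `NumberField.algHom_eq_id_of_forall_comap_heightOneSpectrum` (seat abc-iut-w5-d048).
Nothing here bears on [IUTchIII] Cor. 3.12.
-/

noncomputable section

namespace Literature.AlgebraicGeometry.Frobenioids

namespace FrdI.Cor54Sub

open CategoryTheory Opposite NumberField IsDedekindDomain Literature.IUT.LogVolume ModelFrobenioid

variable {F : Type} [Field F] [NumberField F] {K : Type} [Field K] [Algebra F K]

/-- **(B1) at `C_{K/F}`: `deg_Fr(ρ k) = 1` and `Base(ρ k) = 𝟙` for identity-base linear `k`** (see the module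
docstring for the argument). [cite: MochizukiFrdI2008, Cor. 5.4 p.104] -/
theorem degFr_base_rho_linear_arith
    (hΦ' : ∀ X : (FinSubextCat F K)ᵒᵖ, IsPerfFactorial ((arithDivisorFunctor F K).obj X))
    (Ψ : GpSubfunctor (arithDivisorFunctor F K))
    (ρ : ∀ ⦃a a' : Ψ.ModelOf⦄,
      (((RealificationData.canonical _ hΦ').ofBaseData Ψ).functor.obj a ⟶
        ((RealificationData.canonical _ hΦ').ofBaseData Ψ).functor.obj a') →
      (((RealificationData.canonical _ hΦ').ofBaseData Ψ).functor.obj a ⟶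
        ((RealificationData.canonical _ hΦ').ofBaseData Ψ).functor.obj a'))
    (hcomp : ∀ ⦃a a' a'' : Ψ.ModelOf⦄
      (k : ((RealificationData.canonical _ hΦ').ofBaseData Ψ).functor.obj a ⟶
        ((RealificationData.canonical _ hΦ').ofBaseData Ψ).functor.obj a')
      (l : ((RealificationData.canonical _ hΦ').ofBaseData Ψ).functor.obj a' ⟶
        ((RealificationData.canonical _ hΦ').ofBaseData Ψ).functor.obj a''), ρ (k ≫ l) = ρ k ≫ ρ l)
    (hmap : ∀ ⦃a a' : Ψ.ModelOf⦄ (f : a ⟶ a'),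
      ρ (((RealificationData.canonical _ hΦ').ofBaseData Ψ).functor.map f) =
        ((RealificationData.canonical _ hΦ').ofBaseData Ψ).functor.map f)
    (X : FinSubextCat F K) (γ γ' : Algebra.GrothendieckGroup ((arithDivisorFunctor F K).obj (op X)))
    (k : ((RealificationData.canonical _ hΦ').ofBaseData Ψ).functor.obj ⟨X, γ⟩ ⟶
      ((RealificationData.canonical _ hΦ').ofBaseData Ψ).functor.obj ⟨X, γ'⟩)
    (hd : degFr k = 1) (hb : baseMap k = 𝟙 X) :
    degFr (ρ k) = 1 ∧ baseMap (ρ k) = 𝟙 X := by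
  classical
  -- `Φ(L)` is perf-factorial (as a `Prop` about `Multiplicative (EffArithDivisor L)`, `L = X.L`)
  have hM : IsPerfFactorial (Multiplicative (EffArithDivisor X.L)) := hΦ' (op X)
  -- casts of the components of `k` and `ρ k`
  obtain ⟨z, hz⟩ : ∃ z : hM.Rlf, div k = z := ⟨_, rfl⟩
  obtain ⟨uu, hu⟩ : ∃ uu : ((RealificationData.canonical (arithDivisorFunctor F K) hΦ').realSpan Ψ).toMonoid.obj (op X), unit k = uu := ⟨_, rfl⟩
  obtain ⟨d', hρd⟩ : ∃ d' : ℕ+, degFr (ρ k) = d' := ⟨_, rfl⟩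
  obtain ⟨σ', hρb⟩ : ∃ σ' : X ⟶ X, baseMap (ρ k) = σ' := ⟨_, rfl⟩
  obtain ⟨z', hρz⟩ : ∃ z' : hM.Rlf, div (ρ k) = z' := ⟨_, rfl⟩
  obtain ⟨u', hρu⟩ : ∃ u' : ((RealificationData.canonical (arithDivisorFunctor F K) hΦ').realSpan Ψ).toMonoid.obj (op X), unit (ρ k) = u' := ⟨_, rfl⟩
  -- the coordinates `Θ` at `L = X.L`
  obtain ⟨Θ, -, hΘa, hΘb, -⟩ := ArithRlfCoord.exists_rlfGp_coordinates (L := X.L) hM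
  -- the key inequality at every effective `w` and every place `p`
  have key : ∀ (w : EffArithDivisor X.L) (p : Place X.L),
      (d' : ℝ) * ADivisor.ofArithDivisor X.L (EffArithDivisor.toArithDivisor X.L w) p ≤
        ADivisor.ofArithDivisor X.L (EffArithDivisor.toArithDivisor X.L
          (EffArithDivisor.pullback σ'.toAlgHom.toRingHom w)) p +
        Multiplicative.toAdd (Θ (Algebra.GrothendieckGroup.of z')) p := by
    intro w p
    obtain ⟨kw, zw', -, -, -, -, -, -, -, -, E⟩ := DataHom.rho_translate ((RealificationData.canonical (arithDivisorFunctor F K) hΦ').ofBaseData Ψ) ρ hcomp hmap X γ γ'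
      k hd hb z uu hz hu d' σ' z' u' hρd hρb hρz hρu (Multiplicative.ofAdd w)
    obtain ⟨zw, hzw⟩ : ∃ zw : hM.Rlf, zw' = zw := ⟨_, rfl⟩
    -- naturality: `Φ^rlf(σ̂)(ι w) = ι(σ̂^* w)`
    have e2 : ((RealificationData.canonical (arithDivisorFunctor F K) hΦ').rlf.map σ'.op).hom ((((RealificationData.canonical (arithDivisorFunctor F K) hΦ').ofBaseData Ψ).η.app (op X)).hom (Multiplicative.ofAdd w)) =
        (((RealificationData.canonical (arithDivisorFunctor F K) hΦ').ofBaseData Ψ).η.app (op X)).hom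
          (((arithDivisorFunctor F K).map σ'.op).hom (Multiplicative.ofAdd w)) := by
      have nat := ((RealificationData.canonical (arithDivisorFunctor F K) hΦ').ofBaseData Ψ).η.naturality σ'.op
      have := congrArg (fun φ => (CommMonCat.Hom.hom φ) (Multiplicative.ofAdd w)) nat
      exact this.symm
    rw [e2, hzw] at E
    -- the same identity in `Φ(L)^rlf = hM.Rlf`, with `η = ι` unfolded (definitional)
    have E1 : zw * (hM.toRealification (Perfection.of _ (Multiplicative.ofAdd w))) ^ (d' : ℕ) =
        hM.toRealification (Perfection.of _
          (Multiplicative.ofAdd (EffArithDivisor.pullback σ'.toAlgHom.toRingHom w))) * z' := E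
    -- apply `of`, `Θ`, `toAdd`, evaluate at `p`
    have E' := congrArg (fun x => Multiplicative.toAdd (Θ (Algebra.GrothendieckGroup.of x)) p) E1
    simp only [map_mul, map_pow, hΘa, toAdd_mul, toAdd_pow, toAdd_ofAdd, Finsupp.add_apply,
      Finsupp.smul_apply, nsmul_eq_mul] at E'
    have h0 := hΘb zw p
    linarith
  -- nonnegativity of the constant
  have hC : ∀ p, 0 ≤ Multiplicative.toAdd (Θ (Algebra.GrothendieckGroup.of z')) p := fun p => hΘb z' p
  -- (i) `d' = 1`: archimedean places
  have hd1 : d' = 1 := by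
    obtain ⟨w₀⟩ := (inferInstance : Nonempty (InfinitePlace X.L))
    set C := Multiplicative.toAdd (Θ (Algebra.GrothendieckGroup.of z')) (Sum.inl w₀) with hCdef
    have hC0 : 0 ≤ C := hC _
    let r : NNReal := (C + 1).toNNReal
    have hr : ((r : NNReal) : ℝ) = C + 1 := Real.coe_toNNReal _ (by linarith)
    have K1 := key ((0 : FinitePlace X.L →₀ ℕ), Pi.single w₀ r) (Sum.inl w₀)
    simp only [ADivisor.ofArithDivisor_apply_inl] at K1
    have a1 : (EffArithDivisor.toArithDivisor X.L ((0 : FinitePlace X.L →₀ ℕ), Pi.single w₀ r)).2 w₀ = C + 1 := by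
      show ((Pi.single w₀ r : InfinitePlace X.L → NNReal) w₀ : ℝ) = C + 1
      rw [Pi.single_eq_same, hr]
    have a2 : (EffArithDivisor.toArithDivisor X.L (EffArithDivisor.pullback σ'.toAlgHom.toRingHom
        ((0 : FinitePlace X.L →₀ ℕ), Pi.single w₀ r))).2 w₀ ≤ C + 1 := by
      show ((Pi.single w₀ r : InfinitePlace X.L → NNReal) (w₀.comap σ'.toAlgHom.toRingHom) : ℝ) ≤ C + 1
      by_cases hw : w₀.comap σ'.toAlgHom.toRingHom = w₀
      · rw [hw, Pi.single_eq_same, hr]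
      · rw [Pi.single_eq_of_ne hw, NNReal.coe_zero]; linarith
    rw [a1] at K1
    have hm : (1 : ℝ) ≤ w₀.mult := InfinitePlace.one_le_mult
    have hm0 : (0 : ℝ) ≤ w₀.mult := by linarith
    have K2 : (d' : ℝ) * (w₀.mult * (C + 1)) ≤ w₀.mult * (C + 1) + C := by
      have := mul_le_mul_of_nonneg_left a2 hm0
      linarith
    -- if `d' ≥ 2` this is absurd
    by_contra hne
    have hne1 : (d' : ℕ) ≠ 1 := fun h1 => hne (PNat.coe_inj.mp (h1.trans PNat.one_coe.symm))
    have h2 : (2 : ℝ) ≤ d' := by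
      have : (2 : ℕ) ≤ (d' : ℕ) := by have := d'.pos; omega
      exact_mod_cast this
    have : (2 : ℝ) * (w₀.mult * (C + 1)) ≤ w₀.mult * (C + 1) + C := by
      have := mul_le_mul_of_nonneg_right h2 (by positivity : (0 : ℝ) ≤ w₀.mult * (C + 1))
      linarith
    have : w₀.mult * (C + 1) ≤ C := by linarith
    have : (C + 1) ≤ C := by nlinarith
    linarith
  -- (ii) `σ' = 𝟙`: finite places
  have hfix : ∀ v : HeightOneSpectrum (𝓞 X.L),
      v.asIdeal.comap (RingOfIntegers.mapRingHom (σ'.toAlgHom : X.L →+* X.L)) = v.asIdeal := by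
    intro v
    set C := Multiplicative.toAdd (Θ (Algebra.GrothendieckGroup.of z')) (Sum.inr v) with hCdef
    by_contra hne
    have hne' : ArithPullback.underPlace σ'.toAlgHom.toRingHom (FinitePlace.mk v) ≠ FinitePlace.mk v := by
      intro habs
      apply hne
      have := congrArg FinitePlace.maximalIdeal habs
      rw [ArithPullback.maximalIdeal_underPlace, FinitePlace.maximalIdeal_mk] at this
      exact congrArg HeightOneSpectrum.asIdeal this
    obtain ⟨n, hn⟩ := exists_nat_gt C
    have K1 := key (Finsupp.single (FinitePlace.mk v) n, 0) (Sum.inr v)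
    simp only [ADivisor.ofArithDivisor_apply_inr, hd1, PNat.one_coe, Nat.cast_one, one_mul] at K1
    have a1 : ((EffArithDivisor.toArithDivisor X.L (Finsupp.single (FinitePlace.mk v) n, 0)).1
        (FinitePlace.mk v) : ℝ) = n := by
      show ((Finsupp.mapRange (Nat.cast : ℕ → ℤ) (Nat.cast_zero) (Finsupp.single (FinitePlace.mk v) n))
        (FinitePlace.mk v) : ℝ) = n
      rw [Finsupp.mapRange_apply, Finsupp.single_eq_same]
      push_cast
      rfl
    have a2 : ((EffArithDivisor.toArithDivisor X.L (EffArithDivisor.pullback σ'.toAlgHom.toRingHom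
        (Finsupp.single (FinitePlace.mk v) n, 0))).1 (FinitePlace.mk v) : ℝ) = 0 := by
      show ((Finsupp.mapRange (Nat.cast : ℕ → ℤ) (Nat.cast_zero)
        (ArithPullback.pullFinsupp σ'.toAlgHom.toRingHom (Finsupp.single (FinitePlace.mk v) n)))
          (FinitePlace.mk v) : ℝ) = 0
      rw [Finsupp.mapRange_apply, ArithPullback.pullFinsupp_apply, Finsupp.single_eq_of_ne hne', mul_zero]
      push_cast
      rfl
    rw [a1, a2] at K1
    linarith
  refine ⟨hρd.trans hd1, hρb.trans ?_⟩
  apply FinSubextCat.hom_ext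
  exact Literature.NumberTheory.NumberFields.algHom_eq_id_of_forall_comap_heightOneSpectrum σ'.toAlgHom hfix

end FrdI.Cor54Sub

end Literature.AlgebraicGeometry.Frobenioids
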